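import Mathlib
import Literature.MathematicalPhysics.QuantumFieldTheory.Balaban1983to89.T4ActivityTilt

/-!
# T⁴-continuum spine estimate NE5 (node U3), polymer-activity route — companion §14 of the TILT LEMMA: the REACH LEMMAS —
# the DISPLACED endpoint's one-run data (invertibility, inverse-covariance and resolvent entry decay, normalisation `≠ 0`
# with its determinant-channel constant `ζ`, tilted absolute majorants) PRODUCED from the REFERENCE endpoint's one-run data
# and a small displacement in the weighted entry norm [folklore]

Cell `pub-balaban`, T⁴-continuum fan-out, node U3 / estimate NE5, prover seat P2 (assigned technique: *polymer-activity
Lipschitz route — bound output differences by activity differences via the printed convergence criteria (Kotecký–Preiss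
norm)*), lineage generation 14; FILE v1 (NEW LEAF, the fourth COMPANION MODULE of `T4ActivityTilt` v1.5 = p191365 — frozen
at the gate's size cap —; it imports it, hence `Mathlib` only, and uses its §2, §9.1, §9.3, §10 declarations BY QUALIFIED /
SELECTIVELY OPENED NAME; nothing of it is restated or modified; THEOREMS ONLY, no `def`).  Honest frame of the whole cell
unchanged: rung (B)+1 of a FINITE-VOLUME T⁴ programme; NOT infinite volume, NOT a mass gap, NOT the Clay problem.  Nothing
in this file is an estimate OF [Balaban1988RG2Cluster]; it is [folklore] finite-dimensional linear algebra (Neumann-type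
perturbation of an invertible complex matrix in a weighted entry norm), elementary complex arithmetic and Bochner-integral
bookkeeping, plus a dictionary saying which printed ONE-run KIND of [Balaban1988RG2Cluster] pp. 15–16 the hypothesis
shapes read — every transposition of a ONE-run printed bound to the comparison of TWO runs being NOT PRINTED and flagged so.
ABSOLUTE RULE kept: every hypothesis of every theorem is an explicit binder; no internally-minted statement, no
programme-internal claim and no disputed step of the papers under audit is used as a fact; no `BetaPertH`, (B) or (B^μ) is
hidden in a definition (there is no definition in this file); tree declarations of other seats are cited BY NAME only.

WHERE IT SITS.  Every two-run theorem of `T4ActivityTilt` §2–§10, `T4ActivityTiltPotential` §11 and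
`T4ActivityTiltHistory` §12 carries, besides the REFERENCE endpoint's (run B's) one-run data, the SAME one-run data for
the DISPLACED endpoint (run A): the tilted absolute majorant `∫ e^{uP} e^{−Re Δ}‖F‖ ≤ M_A` and the integrability of the
displaced integrand (shape (ROB), `norm_integral_tilt_sub_le`), the displaced normalisation `z_A ≠ 0` and the doubly tilted
normalisation majorant (`det_of_dom₀`, `opLeg_of_tilt_dom₀`: `hzA`, `hI2`, `hM`, `hMV`), the displaced kernels'
invertibility and one-run decay (`norm_integral_tilt_sub_le_of_resolventBounds`: `hdA`, `hA`, `hLA`, `hRA`, `hCA`).  In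
the two-species datum `T4ActivityRecursion.InputModel.ActivityLipschitz₂` (v1.4 §9.2; the lineage's wall G-ne5p2-3′) the
displaced point `q` is ARBITRARY within reach `ρ₀` of a base point `p`, and only `p` carries data (`Base`,
`BaseMajorant`): so the displaced endpoint's data must be PRODUCED from the reference endpoint's data and the smallness of
the displacement.  That production is this file — four [folklore] REACH LEMMAS, each with every hypothesis an explicit
binder and a toy instance:
  §14.1 INVERTIBILITY IS OPEN: `IsUnit (P + E).det` from `IsUnit P.det` and row sums `Σ_{a′}‖(P⁻¹E)(a, a′)‖ ≤ μ < 1`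
        (`isUnit_det_add_of_rowSum`; kernel argument at a maximal coordinate, `Matrix.mulVec_injective_iff_isUnit`), the
        row sums themselves produced from entry decay (`rowSum_inv_mul_le`: `≤ c·r·K²`).
  §14.2 INVERSE DECAY IS OPEN: if `‖P⁻¹(a, a′)‖ ≤ c e^{−δd}` and `‖E(a, a′)‖ ≤ r e^{−δd}` with `c r K² < 1` (`K` the
        half-rate lattice sums), then `‖(P + E)⁻¹(a, a′)‖ ≤ c/(1 − c r K²)·e^{−(δ/2)d}` (`norm_inv_add_entry_le`: the
        resolvent identity `(P + E)⁻¹ = P⁻¹ − P⁻¹E(P + E)⁻¹` — `T4ActivityTilt.inv_sub_inv` BY NAME — closed by an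
        A-PRIORI bound on the finite weighted sup `Φ = max ‖(P + E)⁻¹(a, a′)‖e^{(δ/2)d}`, two applications of
        `T4ActivityTilt.norm_sum_mul_le_of_decay`); packaged with §14.1 as `inv_near`, and along the resolvent family
        `u ↦ (u²·𝟙 + A)⁻¹` with the Lorentzian amplitude kept (`resolvent_near`: `∀ u`, invertibility of
        `u²·𝟙 + A + E` and `‖R_{A+E}(u)(i, j)‖ ≤ c/(1 − c r K²)·a/(a + u²)·e^{−(δ/2)d}`, uniformly because `a/(a + u²) ≤ 1`).
  §14.3 THE NORMALISATION IS OPEN (determinant bootstrap): if `‖z_q − z_p‖ ≤ E₀` and `2E₀ ≤ ‖z_p‖` then `z_q ≠ 0`,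
        `‖z_q‖ ≥ ‖z_p‖/2` and `‖z_p/z_q − 1‖ ≤ 2E₀/‖z_p‖` (`near_ne_zero`); with `E₀ = (ρ₀/(e u₀))(M₀A + M₀B)` from
        `T4ActivityTilt.norm_integral_tilt_sub_le` on the normalisation space this DISCHARGES the hypothesis `z_A ≠ 0` of
        §3/§7 and gives the determinant-channel constant `ζ` in units of the REFERENCE normalisation (`det_of_reach`) —
        no division by the displaced `‖z_A‖` remains.
  §14.4 THE MAJORANTS ARE OPEN (majorant transfer): under an affine domination `‖Δ‖ ≤ ρP + β`, `P ≥ 0`, the displaced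
        tilted weight is under the reference weight WITH ROOM, `e^{uP}e^{−Re Δ} ≤ e^{β}e^{u′P}` for `u + ρ ≤ u′`
        (`tilted_weight_le`); hence (ROB) for the displaced endpoint, INCLUDING its integrability, from the reference
        endpoint's majorant at the larger growth parameter `u′` and the measurability of `Δ`, `P`, `F`
        (`majorant_transfer`), and the integrability of the displaced integrand `e^{−Δ}•F` itself (`integrable_tilted`).
  §14.5 bookkeeping one-liners used downstream (`norm_le_of_near`, `self_le_div_one_sub`) and the toy instances.
What this buys for the wall: in a term model whose operator slot is the tuple of RESCALED kernels (next companion module),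
the base datum of a point `p` consists of ONE-run data of printed KIND at `p` WITH ROOM (decay at rate `2δ`, majorants at
growth `u′ > u`, `2E₀ ≤ ‖z_p‖`), and every displaced-endpoint hypothesis of §2–§12 at `q` follows for
`‖q − p‖ ≤ ρ₀ϱ` — so the NOT-PRINTED two-spacing content is confined to the RATE data (`OperatorRate`, `InsertionRate`),
not to the regularity datum.  Smallness census of this file: `c r K² < 1` (§14.1–§14.2) and `2E₀ ≤ ‖z_p‖` (§14.3) — both
REACH conditions on the displacement `r`, `ρ₀`, i.e. restrictions of the radius `ρ₀` of `ActivityLipschitz₂`, never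
conditions on print's constants.

DICTIONARY (which printed KIND the binders read; the transposition to two runs NOT PRINTED).  `P`, `E` ↦ a run's
inverse covariance `C^{(k)}(Z₀, σ(Z))⁻¹` in (2.15) and its displacement; `A` ↦ the operator under the square root of
(2.7); entry decay `c e^{−δ d}` ↦ the (2.16) KIND, p. 15 *"In the expression on the right-hand side we replace the
operators by the corresponding operators with σ(Z) = 0, 𝐔 = U, 𝐉 = 0, and we estimate the error. For the quadratic form in
the first exponential the difference is a quadratic form"* p. 16 *"½⟨X, R₁X⟩, with matrix elements satisfying the bound"*
(2.16) `|R₁(b, b′)| ≤ (O(1)e^{−1/3 δ₀M} + O(α₀ + α₁)) exp(−½δ₀|b₋ − b′₋|)`; the normalisations `z_p`, `z_q` and `ζ` ↦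
p. 16 *"Similarly, the next Gaussian measure is replaced by the measure with the new covariance, multiplied by a quotient
of determinants, which can be estimated by (2.17)"* — print estimates ONE run's quotient against the `σ(Z) = 0` reference;
the two-run quotient `z_p/z_q` is NOT PRINTED; the majorants `M` ↦ the (2.23)–(2.26) KIND as in `T4ActivityTilt` §2's
dictionary.  Tree precedents BY NAME (not imported): `King1986.CovarianceRate.inv_sub_inv_of_isUnit`,
`T4EtaRateDefect.hasMaj_apriori_weighted` (sibling seat pv25: the same a-priori-weighted-sup idea for intertwining defects
over `B11SectG.HasMaj`; here for the plain inverse in `T4ActivityTilt`'s entry format, which is what §10's junction consumes).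

PROVENANCE.  Cell journal `CLAIMS.log` (rotated 2026-08-19T18:57Z): this generation's claim `T4-U3.E-NE5-PROVE-P2n*`
(l.728); record `t4/T4-EST-U3-NE5-P2.md` §0(u)/§5 (40).

VERSIONS.  v1 (gen 14): NEW LEAF — §14.1–§14.5 as above.
-/

noncomputable section

open MeasureTheory

namespace Literature.MathematicalPhysics.QuantumFieldTheory.Balaban1983to89.T4ActivityReach

open Literature.MathematicalPhysics.QuantumFieldTheory.Balaban1983to89.T4ActivityTilt
  (norm_sum_mul_le_of_decay inv_sub_inv lorentz lorentz_nonneg lorentz_le_one norm_integral_tilt_sub_le)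

variable {κ ι S Ω Ω₀ : Type*} [Fintype κ] [DecidableEq κ] [Fintype ι] [DecidableEq ι]
variable {E : Type*} [NormedAddCommGroup E]

/-! ## §14.1 Invertibility is open: `IsUnit (P + E).det` from the row sums of `P⁻¹E` [folklore] -/

/-- [folklore] INVERTIBILITY IS OPEN.  If `P` is invertible and the row sums of `P⁻¹E` are `≤ μ < 1`, then `P + E` is
invertible: a kernel vector `z` of `P + E` satisfies `z = −P⁻¹E z`, and at a coordinate where `‖z a‖` is maximal this
forces `‖z a‖ ≤ μ‖z a‖`, so `z = 0`; injectivity of `mulVec` is invertibility (`Matrix.mulVec_injective_iff_isUnit`).  No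
matrix norm instance is used. -/
theorem isUnit_det_add_of_rowSum (P E : Matrix κ κ ℂ) (hP : IsUnit P.det) {μ : ℝ} (hμ1 : μ < 1)
    (hμ : ∀ a, ∑ a', ‖(P⁻¹ * E) a a'‖ ≤ μ) : IsUnit (P + E).det := by
  rw [← Matrix.isUnit_iff_isUnit_det, ← Matrix.mulVec_injective_iff_isUnit]
  intro v w hvw
  set z : κ → ℂ := v - w with hz_def
  have hz : (P + E).mulVec z = 0 := by
    rw [hz_def, Matrix.mulVec_sub]; exact sub_eq_zero.mpr hvw
  have h1 : P.mulVec z = -(E.mulVec z) := by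
    rw [Matrix.add_mulVec] at hz
    exact eq_neg_of_add_eq_zero_left hz
  have hfix : z = -((P⁻¹ * E).mulVec z) := by
    calc z = (P⁻¹ * P).mulVec z := by rw [Matrix.nonsing_inv_mul _ hP, Matrix.one_mulVec]
      _ = P⁻¹.mulVec (P.mulVec z) := by rw [Matrix.mulVec_mulVec]
      _ = -((P⁻¹ * E).mulVec z) := by rw [h1, Matrix.mulVec_neg, Matrix.mulVec_mulVec]
  rcases isEmpty_or_nonempty κ with hκ | hκ
  · exact funext fun a => (IsEmpty.false a).elim
  obtain ⟨a₀, ha₀⟩ := Finite.exists_max fun a => ‖z a‖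
  have e' : ‖z a₀‖ = ‖∑ j, (P⁻¹ * E) a₀ j * z j‖ := by
    have e := congrFun hfix a₀
    rw [Pi.neg_apply] at e
    rw [e, norm_neg]
    simp only [Matrix.mulVec, dotProduct]
  have hsum : ‖∑ j, (P⁻¹ * E) a₀ j * z j‖ ≤ μ * ‖z a₀‖ :=
    calc ‖∑ j, (P⁻¹ * E) a₀ j * z j‖ ≤ ∑ j, ‖(P⁻¹ * E) a₀ j * z j‖ := norm_sum_le _ _
      _ ≤ ∑ j, ‖(P⁻¹ * E) a₀ j‖ * ‖z a₀‖ := Finset.sum_le_sum fun j _ => by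
          rw [norm_mul]; exact mul_le_mul_of_nonneg_left (ha₀ j) (norm_nonneg _)
      _ = (∑ j, ‖(P⁻¹ * E) a₀ j‖) * ‖z a₀‖ := by rw [Finset.sum_mul]
      _ ≤ μ * ‖z a₀‖ := mul_le_mul_of_nonneg_right (hμ a₀) (norm_nonneg _)
  have key : ‖z a₀‖ ≤ μ * ‖z a₀‖ := e' ▸ hsum
  have h0 : ‖z a₀‖ = 0 := by
    have hn := norm_nonneg (z a₀)
    nlinarith
  funext a
  have ha := ha₀ a
  rw [h0] at ha
  have hza : z a = 0 := norm_le_zero_iff.mp ha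
  rw [hz_def, Pi.sub_apply] at hza
  exact sub_eq_zero.mp hza

/-- [folklore] The entries of `P⁻¹E` from entry decay (King (4.41) KIND): `‖P⁻¹(a, a′)‖ ≤ c e^{−δ d}` and `‖E(a, a′)‖ ≤
r e^{−δ d}` give `‖(P⁻¹E)(a, a′)‖ ≤ c r K e^{−(δ/2) d}`, `K` bounding the half-rate lattice sums
(`T4ActivityTilt.norm_sum_mul_le_of_decay` BY NAME). -/
theorem norm_inv_mul_entry_le (d : S → S → ℝ) (hd0 : ∀ s t, 0 ≤ d s t) (htri : ∀ s t w, d s w ≤ d s t + d t w)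
    (q : κ → S) (P E : Matrix κ κ ℂ) {c r δ K : ℝ} (hc : 0 ≤ c) (hr : 0 ≤ r) (hδ : 0 ≤ δ)
    (hinv : ∀ a a', ‖(P⁻¹) a a'‖ ≤ c * Real.exp (-(δ * d (q a) (q a'))))
    (hE : ∀ a a', ‖E a a'‖ ≤ r * Real.exp (-(δ * d (q a) (q a'))))
    (hK : ∀ s, ∑ a, Real.exp (-(δ / 2 * d s (q a))) ≤ K) (a a' : κ) :
    ‖(P⁻¹ * E) a a'‖ ≤ c * r * K * Real.exp (-(δ / 2 * d (q a) (q a'))) := by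
  rw [Matrix.mul_apply]
  exact norm_sum_mul_le_of_decay d hd0 htri q (q a) (q a') (fun b => (P⁻¹) a b) (fun b => E b a')
    (ρ₁ := δ) (ρ₂ := δ) (σ := δ / 2) (ρ := δ / 2) hc hr (by positivity) (by linarith) (by linarith)
    (fun b => hinv a b) (fun b => hE b a') (hK (q a))

/-- [folklore] THE ROW SUMS of `P⁻¹E` from entry decay: `Σ_{a′}‖(P⁻¹E)(a, a′)‖ ≤ c r K²`. -/
theorem rowSum_inv_mul_le (d : S → S → ℝ) (hd0 : ∀ s t, 0 ≤ d s t) (htri : ∀ s t w, d s w ≤ d s t + d t w)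
    (q : κ → S) (P E : Matrix κ κ ℂ) {c r δ K : ℝ} (hc : 0 ≤ c) (hr : 0 ≤ r) (hδ : 0 ≤ δ)
    (hinv : ∀ a a', ‖(P⁻¹) a a'‖ ≤ c * Real.exp (-(δ * d (q a) (q a'))))
    (hE : ∀ a a', ‖E a a'‖ ≤ r * Real.exp (-(δ * d (q a) (q a'))))
    (hK : ∀ s, ∑ a, Real.exp (-(δ / 2 * d s (q a))) ≤ K) (a : κ) :
    ∑ a', ‖(P⁻¹ * E) a a'‖ ≤ c * r * K ^ 2 := by
  have hK0 : 0 ≤ K := (Finset.sum_nonneg fun _ _ => (Real.exp_pos _).le).trans (hK (q a))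
  calc ∑ a', ‖(P⁻¹ * E) a a'‖ ≤ ∑ a', c * r * K * Real.exp (-(δ / 2 * d (q a) (q a'))) :=
        Finset.sum_le_sum fun a' _ => norm_inv_mul_entry_le d hd0 htri q P E hc hr hδ hinv hE hK a a'
    _ = c * r * K * ∑ a', Real.exp (-(δ / 2 * d (q a) (q a'))) := by rw [Finset.mul_sum]
    _ ≤ c * r * K * K := mul_le_mul_of_nonneg_left (hK (q a)) (by positivity)
    _ = c * r * K ^ 2 := by ring

/-! ## §14.2 Inverse decay is open: the entries of `(P + E)⁻¹` by an a-priori weighted sup [folklore] -/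

/-- [folklore] INVERSE DECAY IS OPEN (the a-priori argument).  If `P` and `P + E` are invertible, `‖P⁻¹(a, a′)‖ ≤ c e^{−δd}`,
`‖E(a, a′)‖ ≤ r e^{−δd}`, the half-rate lattice sums are `≤ K` and `c r K² < 1`, then
`‖(P + E)⁻¹(a, a′)‖ ≤ c/(1 − c r K²)·e^{−(δ/2) d(q a, q a′)}`.  Proof: `Q = (P + E)⁻¹ = P⁻¹ − P⁻¹EQ`
(`T4ActivityTilt.inv_sub_inv`); the FINITE weighted sup `Φ = max_{a,a′} ‖Q(a, a′)‖e^{(δ/2)d}` satisfies, at a maximising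
pair, `Φ ≤ c + c r K² Φ` (two `norm_sum_mul_le_of_decay`, output rate `δ/2`, summation share `δ/2`), whence
`Φ ≤ c/(1 − c r K²)`.  No Neumann series, no matrix norm. -/
theorem norm_inv_add_entry_le (d : S → S → ℝ) (hd0 : ∀ s t, 0 ≤ d s t) (htri : ∀ s t w, d s w ≤ d s t + d t w)
    (q : κ → S) (P E : Matrix κ κ ℂ) (hP : IsUnit P.det) (hPE : IsUnit (P + E).det) {c r δ K : ℝ}
    (hc : 0 ≤ c) (hr : 0 ≤ r) (hδ : 0 ≤ δ)
    (hinv : ∀ a a', ‖(P⁻¹) a a'‖ ≤ c * Real.exp (-(δ * d (q a) (q a'))))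
    (hE : ∀ a a', ‖E a a'‖ ≤ r * Real.exp (-(δ * d (q a) (q a'))))
    (hK : ∀ s, ∑ a, Real.exp (-(δ / 2 * d s (q a))) ≤ K) (hsmall : c * r * K ^ 2 < 1) (a a' : κ) :
    ‖((P + E)⁻¹) a a'‖ ≤ c / (1 - c * r * K ^ 2) * Real.exp (-(δ / 2 * d (q a) (q a'))) := by
  have hK0 : 0 ≤ K := (Finset.sum_nonneg fun _ _ => (Real.exp_pos _).le).trans (hK (q a))
  have hid : (P + E)⁻¹ = P⁻¹ - P⁻¹ * E * (P + E)⁻¹ := by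
    have h := inv_sub_inv P (P + E) hP hPE
    rw [add_sub_cancel_left] at h
    rw [← h]; abel
  set Q : Matrix κ κ ℂ := (P + E)⁻¹ with hQ_def
  have hentry : ∀ b b', Q b b' = (P⁻¹) b b' - ∑ l, (P⁻¹) b l * ∑ l', E l l' * Q l' b' := by
    intro b b'
    have h := congrArg (fun N : Matrix κ κ ℂ => N b b') hid
    simp only [Matrix.sub_apply] at h
    rw [h]
    congr 1
    simp only [Matrix.mul_apply, Finset.sum_mul, Finset.mul_sum]
    rw [Finset.sum_comm]
    refine Finset.sum_congr rfl fun l _ => Finset.sum_congr rfl fun l' _ => ?_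
    ring
  haveI : Nonempty κ := ⟨a⟩
  obtain ⟨x₀, hx₀⟩ :=
    Finite.exists_max fun x : κ × κ => ‖Q x.1 x.2‖ * Real.exp (δ / 2 * d (q x.1) (q x.2))
  set Φ : ℝ := ‖Q x₀.1 x₀.2‖ * Real.exp (δ / 2 * d (q x₀.1) (q x₀.2)) with hΦ_def
  have hΦ0 : 0 ≤ Φ := mul_nonneg (norm_nonneg _) (Real.exp_pos _).le
  have hQb : ∀ b b', ‖Q b b'‖ ≤ Φ * Real.exp (-(δ / 2 * d (q b) (q b'))) := by
    intro b b'
    have h := hx₀ (b, b')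
    rw [Real.exp_neg, ← div_eq_mul_inv, le_div_iff₀ (Real.exp_pos _)]
    exact h
  have inner : ∀ l, ‖∑ l', E l l' * Q l' x₀.2‖ ≤ r * Φ * K * Real.exp (-(δ / 2 * d (q l) (q x₀.2))) :=
    fun l => norm_sum_mul_le_of_decay d hd0 htri q (q l) (q x₀.2) (fun l' => E l l') (fun l' => Q l' x₀.2)
      (ρ₁ := δ) (ρ₂ := δ / 2) (σ := δ / 2) (ρ := δ / 2) hr hΦ0 (by positivity) (by linarith) le_rfl
      (fun l' => hE l l') (fun l' => hQb l' x₀.2) (hK (q l))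
  have outer : ‖∑ l, (P⁻¹) x₀.1 l * ∑ l', E l l' * Q l' x₀.2‖
      ≤ c * (r * Φ * K) * K * Real.exp (-(δ / 2 * d (q x₀.1) (q x₀.2))) :=
    norm_sum_mul_le_of_decay d hd0 htri q (q x₀.1) (q x₀.2) (fun l => (P⁻¹) x₀.1 l)
      (fun l => ∑ l', E l l' * Q l' x₀.2) (ρ₁ := δ) (ρ₂ := δ / 2) (σ := δ / 2) (ρ := δ / 2) hc
      (by positivity) (by positivity) (by linarith) le_rfl (fun l => hinv x₀.1 l) inner (hK (q x₀.1))
  have hmain : ‖Q x₀.1 x₀.2‖ ≤ (c + c * r * K ^ 2 * Φ) * Real.exp (-(δ / 2 * d (q x₀.1) (q x₀.2))) := by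
    rw [hentry x₀.1 x₀.2]
    have e1 : Real.exp (-(δ * d (q x₀.1) (q x₀.2))) ≤ Real.exp (-(δ / 2 * d (q x₀.1) (q x₀.2))) :=
      Real.exp_le_exp.mpr (by nlinarith [hd0 (q x₀.1) (q x₀.2)])
    calc ‖(P⁻¹) x₀.1 x₀.2 - ∑ l, (P⁻¹) x₀.1 l * ∑ l', E l l' * Q l' x₀.2‖
        ≤ ‖(P⁻¹) x₀.1 x₀.2‖ + ‖∑ l, (P⁻¹) x₀.1 l * ∑ l', E l l' * Q l' x₀.2‖ := norm_sub_le _ _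
      _ ≤ c * Real.exp (-(δ * d (q x₀.1) (q x₀.2)))
          + c * (r * Φ * K) * K * Real.exp (-(δ / 2 * d (q x₀.1) (q x₀.2))) := add_le_add (hinv _ _) outer
      _ ≤ c * Real.exp (-(δ / 2 * d (q x₀.1) (q x₀.2)))
          + c * (r * Φ * K) * K * Real.exp (-(δ / 2 * d (q x₀.1) (q x₀.2))) :=
          add_le_add (mul_le_mul_of_nonneg_left e1 hc) le_rfl
      _ = (c + c * r * K ^ 2 * Φ) * Real.exp (-(δ / 2 * d (q x₀.1) (q x₀.2))) := by ring
  have hΦle : Φ ≤ c + c * r * K ^ 2 * Φ := by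
    have h := mul_le_mul_of_nonneg_right hmain (Real.exp_pos (δ / 2 * d (q x₀.1) (q x₀.2))).le
    rw [mul_assoc, ← Real.exp_add, neg_add_cancel, Real.exp_zero, mul_one] at h
    exact h
  have hden : 0 < 1 - c * r * K ^ 2 := by linarith
  have hΦbd : Φ ≤ c / (1 - c * r * K ^ 2) := by
    rw [le_div_iff₀ hden]; nlinarith
  calc ‖Q a a'‖ ≤ Φ * Real.exp (-(δ / 2 * d (q a) (q a'))) := hQb a a'
    _ ≤ c / (1 - c * r * K ^ 2) * Real.exp (-(δ / 2 * d (q a) (q a'))) :=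
        mul_le_mul_of_nonneg_right hΦbd (Real.exp_pos _).le

/-- [folklore] THE INVERSE-COVARIANCE REACH LEMMA (§14.1 + §14.2 packaged): from the REFERENCE endpoint's invertibility and
inverse decay (`IsUnit P.det`, `‖P⁻¹(a, a′)‖ ≤ c e^{−δd}`) and a displacement `E` of entry size `r e^{−δd}` with
`c r K² < 1`: the DISPLACED endpoint `P + E` is invertible and `‖(P + E)⁻¹(a, a′)‖ ≤ c/(1 − c r K²)·e^{−(δ/2)d}` — exactly
the displaced-endpoint hypotheses `hA`, `hCA` of `T4ActivityTilt.norm_integral_tilt_sub_le_of_resolventBounds` (at rate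
`δ/2`, to be entered together with the reference data weakened to that rate by `entryBound_mono`). -/
theorem inv_near (d : S → S → ℝ) (hd0 : ∀ s t, 0 ≤ d s t) (htri : ∀ s t w, d s w ≤ d s t + d t w)
    (q : κ → S) (P E : Matrix κ κ ℂ) (hP : IsUnit P.det) {c r δ K : ℝ} (hc : 0 ≤ c) (hr : 0 ≤ r) (hδ : 0 ≤ δ)
    (hinv : ∀ a a', ‖(P⁻¹) a a'‖ ≤ c * Real.exp (-(δ * d (q a) (q a'))))
    (hE : ∀ a a', ‖E a a'‖ ≤ r * Real.exp (-(δ * d (q a) (q a'))))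
    (hK : ∀ s, ∑ a, Real.exp (-(δ / 2 * d s (q a))) ≤ K) (hsmall : c * r * K ^ 2 < 1) :
    IsUnit (P + E).det ∧
      ∀ a a', ‖((P + E)⁻¹) a a'‖ ≤ c / (1 - c * r * K ^ 2) * Real.exp (-(δ / 2 * d (q a) (q a'))) := by
  have hPE : IsUnit (P + E).det :=
    isUnit_det_add_of_rowSum P E hP hsmall (rowSum_inv_mul_le d hd0 htri q P E hc hr hδ hinv hE hK)
  exact ⟨hPE, norm_inv_add_entry_le d hd0 htri q P E hP hPE hc hr hδ hinv hE hK hsmall⟩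

/-- [folklore] THE RESOLVENT REACH LEMMA: along the family `u ↦ u²·𝟙 + A` of print's (2.7) square root (dictionary of
`T4ActivityTilt` §10), if the REFERENCE operator's shifts are invertible with `‖R_A(u)(i, j)‖ ≤ c·a/(a + u²)·e^{−δd}`
(`T4ActivityTilt.resolvent`, `lorentz`) and `‖E(i, j)‖ ≤ r e^{−δd}` with `c r K² < 1`, then for EVERY `u` the displaced
shift `u²·𝟙 + (A + E)` is invertible and `‖R_{A+E}(u)(i, j)‖ ≤ c/(1 − c r K²)·a/(a + u²)·e^{−(δ/2)d}` — the
displaced-endpoint hypotheses `hdA`, `hRA` of §10's junction.  Uniformity in `u`: `inv_near` at amplitude `c·a/(a + u²)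
≤ c`. -/
theorem resolvent_near (d : S → S → ℝ) (hd0 : ∀ s t, 0 ≤ d s t) (htri : ∀ s t w, d s w ≤ d s t + d t w)
    (p : ι → S) (A E : Matrix ι ι ℂ)
    (hdA : ∀ u : ℝ, IsUnit ((((u ^ 2 : ℝ) : ℂ)) • (1 : Matrix ι ι ℂ) + A).det)
    {c a r δ K : ℝ} (hc : 0 ≤ c) (ha : 0 < a) (hr : 0 ≤ r) (hδ : 0 ≤ δ)
    (hRA : ∀ (u : ℝ) (i j : ι),
      ‖T4ActivityTilt.resolvent A u i j‖ ≤ c * lorentz a u * Real.exp (-(δ * d (p i) (p j))))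
    (hE : ∀ i j, ‖E i j‖ ≤ r * Real.exp (-(δ * d (p i) (p j))))
    (hK : ∀ s, ∑ i, Real.exp (-(δ / 2 * d s (p i))) ≤ K) (hsmall : c * r * K ^ 2 < 1) :
    (∀ u : ℝ, IsUnit ((((u ^ 2 : ℝ) : ℂ)) • (1 : Matrix ι ι ℂ) + (A + E)).det) ∧
      ∀ (u : ℝ) (i j : ι), ‖T4ActivityTilt.resolvent (A + E) u i j‖
        ≤ c / (1 - c * r * K ^ 2) * lorentz a u * Real.exp (-(δ / 2 * d (p i) (p j))) := by
  rcases isEmpty_or_nonempty ι with hι | hι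
  · refine ⟨fun u => ?_, fun u i j => (IsEmpty.false i).elim⟩
    rw [Matrix.det_isEmpty]; exact isUnit_one
  obtain ⟨i₀⟩ := hι
  have hK0 : 0 ≤ K := (Finset.sum_nonneg fun _ _ => (Real.exp_pos _).le).trans (hK (p i₀))
  have hden : 0 < 1 - c * r * K ^ 2 := by linarith
  have step : ∀ u : ℝ, IsUnit ((((u ^ 2 : ℝ) : ℂ)) • (1 : Matrix ι ι ℂ) + (A + E)).det ∧
      ∀ i j, ‖T4ActivityTilt.resolvent (A + E) u i j‖
        ≤ c / (1 - c * r * K ^ 2) * lorentz a u * Real.exp (-(δ / 2 * d (p i) (p j))) := by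
    intro u
    have hl0 := lorentz_nonneg ha u
    have hl1 := lorentz_le_one ha u
    have hcu : 0 ≤ c * lorentz a u := mul_nonneg hc hl0
    have hcle : c * lorentz a u * r * K ^ 2 ≤ c * r * K ^ 2 := by
      have : c * lorentz a u ≤ c := by nlinarith
      have hrK : 0 ≤ r * K ^ 2 := by positivity
      nlinarith
    have hsmall_u : c * lorentz a u * r * K ^ 2 < 1 := lt_of_le_of_lt hcle hsmall
    have hinv_u : ∀ i j, ‖((((u ^ 2 : ℝ) : ℂ)) • (1 : Matrix ι ι ℂ) + A)⁻¹ i j‖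
        ≤ c * lorentz a u * Real.exp (-(δ * d (p i) (p j))) := hRA u
    have h := inv_near d hd0 htri p ((((u ^ 2 : ℝ) : ℂ)) • (1 : Matrix ι ι ℂ) + A) E (hdA u) hcu hr hδ
      hinv_u hE hK hsmall_u
    rw [add_assoc] at h
    refine ⟨h.1, fun i j => (h.2 i j).trans ?_⟩
    apply mul_le_mul_of_nonneg_right _ (Real.exp_pos _).le
    have hden_u : 0 < 1 - c * lorentz a u * r * K ^ 2 := by linarith
    rw [div_le_iff₀ hden_u, div_mul_eq_mul_div, div_mul_eq_mul_div, le_div_iff₀ hden]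
    have h1 : c * lorentz a u * (1 - c * r * K ^ 2) ≤ c * lorentz a u * (1 - c * lorentz a u * r * K ^ 2) :=
      mul_le_mul_of_nonneg_left (by linarith) hcu
    calc c * lorentz a u * (1 - c * r * K ^ 2)
        ≤ c * lorentz a u * (1 - c * lorentz a u * r * K ^ 2) := h1
      _ = c * lorentz a u * (1 - c * lorentz a u * r * K ^ 2) := rfl
      _ = c * lorentz a u * (1 - c * lorentz a u * r * K ^ 2) := rfl
      _ = (c * lorentz a u) * (1 - c * lorentz a u * r * K ^ 2) := by ring
  exact ⟨fun u => (step u).1, fun u => (step u).2⟩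

/-! ## §14.3 The normalisation is open: the determinant bootstrap [folklore] -/

/-- [folklore] THE DETERMINANT BOOTSTRAP (pure complex arithmetic).  If `z_p ≠ 0`, `‖z_q − z_p‖ ≤ E₀` and the reach
condition `2E₀ ≤ ‖z_p‖` holds, then `z_q ≠ 0`, `‖z_q‖ ≥ ‖z_p‖/2`, and the determinant-channel constant of
`T4ActivityTilt.norm_tiltedTerm_sub_le` (its `hζ : ‖z_B/z_A − 1‖ ≤ ζ`, `A` = displaced, `B` = reference) is
`ζ = 2E₀/‖z_p‖` — in units of the REFERENCE normalisation only. -/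
theorem near_ne_zero {zp zq : ℂ} {E₀ : ℝ} (hzp : zp ≠ 0) (h : ‖zq - zp‖ ≤ E₀) (hreach : 2 * E₀ ≤ ‖zp‖) :
    zq ≠ 0 ∧ ‖zp‖ / 2 ≤ ‖zq‖ ∧ ‖zp / zq - 1‖ ≤ 2 * E₀ / ‖zp‖ := by
  have hp : 0 < ‖zp‖ := norm_pos_iff.mpr hzp
  rw [norm_sub_rev] at h
  have hE0 : 0 ≤ E₀ := (norm_nonneg _).trans h
  have hq : ‖zp‖ / 2 ≤ ‖zq‖ := by
    have := norm_sub_norm_le zp zq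
    linarith
  have hq0 : 0 < ‖zq‖ := by linarith
  have hzq : zq ≠ 0 := norm_pos_iff.mp hq0
  refine ⟨hzq, hq, ?_⟩
  rw [div_sub_one hzq, norm_div, div_le_div_iff₀ hq0 hp]
  have h1 : 0 ≤ (E₀ - ‖zp - zq‖) * ‖zp‖ := mul_nonneg (sub_nonneg.mpr h) hp.le
  have h2 : 0 ≤ E₀ * (2 * ‖zq‖ - ‖zp‖) := mul_nonneg hE0 (by linarith)
  nlinarith

/-- [folklore] THE NORMALISATION REACH LEMMA.  On the normalisation space (`T4ActivityTilt` §7's `Ω₀, ν₀, φ, Δ₀, P₀`):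
the reference normalisation `z_p = ∫ φ dν₀ ≠ 0`, the linear domination `‖Δ₀‖ ≤ ρ₀P₀` (DOM₀), the two tilted normalisation
majorants at growth `u₀` (the displaced one PRODUCED by §14.4 from the reference one at growth `u₀ + ρ₀`, if wished) and
the REACH CONDITION `2E₀ ≤ ‖z_p‖`, `E₀ = (ρ₀/(e u₀))(M₀A + M₀B)`, give: the displaced normalisation
`z_q = ∫ e^{−Δ₀}•φ dν₀ ≠ 0` (this DISCHARGES `hzA` of `det_of_dom₀` / `opLeg_of_tilt_dom₀` / `norm_tiltedTerm_sub_le`),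
`‖z_q‖ ≥ ‖z_p‖/2`, and `‖z_p/z_q − 1‖ ≤ 2E₀/‖z_p‖` (`T4ActivityTilt.norm_integral_tilt_sub_le` BY NAME + `near_ne_zero`). -/
theorem det_of_reach [MeasurableSpace Ω₀] (ν₀ : Measure Ω₀) (φ : Ω₀ → ℂ) (Δ₀ : Ω₀ → ℂ) (P₀ : Ω₀ → ℝ)
    {ρ₀ u₀ M₀A M₀B : ℝ} (hρ₀ : 0 ≤ ρ₀) (hu₀ : 0 < u₀)
    (hdom₀ : ∀ y, ‖Δ₀ y‖ ≤ ρ₀ * P₀ y)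
    (hφ : Integrable φ ν₀) (hφA : Integrable (fun y => Complex.exp (-Δ₀ y) • φ y) ν₀)
    (hI0B : Integrable (fun y => Real.exp (u₀ * P₀ y) * ‖φ y‖) ν₀)
    (hM0B : ∫ y, Real.exp (u₀ * P₀ y) * ‖φ y‖ ∂ν₀ ≤ M₀B)
    (hI0A : Integrable (fun y => Real.exp (u₀ * P₀ y) * Real.exp (-(Δ₀ y).re) * ‖φ y‖) ν₀)
    (hM0A : ∫ y, Real.exp (u₀ * P₀ y) * Real.exp (-(Δ₀ y).re) * ‖φ y‖ ∂ν₀ ≤ M₀A)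
    (hzp : (∫ y, φ y ∂ν₀) ≠ 0)
    (hreach : 2 * (ρ₀ / (Real.exp 1 * u₀) * (M₀A + M₀B)) ≤ ‖∫ y, φ y ∂ν₀‖) :
    (∫ y, Complex.exp (-Δ₀ y) • φ y ∂ν₀) ≠ 0 ∧
      ‖∫ y, φ y ∂ν₀‖ / 2 ≤ ‖∫ y, Complex.exp (-Δ₀ y) • φ y ∂ν₀‖ ∧
      ‖(∫ y, φ y ∂ν₀) / (∫ y, Complex.exp (-Δ₀ y) • φ y ∂ν₀) - 1‖
        ≤ 2 * (ρ₀ / (Real.exp 1 * u₀) * (M₀A + M₀B)) / ‖∫ y, φ y ∂ν₀‖ := by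
  have h := norm_integral_tilt_sub_le ν₀ φ Δ₀ P₀ hρ₀ hu₀ hdom₀ hI0B hM0B hI0A hM0A
  have e : ∫ y, (Complex.exp (-Δ₀ y) - 1) • φ y ∂ν₀
      = (∫ y, Complex.exp (-Δ₀ y) • φ y ∂ν₀) - ∫ y, φ y ∂ν₀ := by
    rw [← integral_sub hφA hφ]
    refine integral_congr_ae (Filter.Eventually.of_forall fun y => ?_)
    simp only [sub_smul, one_smul]
  rw [e] at h
  exact near_ne_zero hzp h hreach

/-! ## §14.4 The majorants are open: majorant transfer under an affine domination [folklore] -/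

/-- [folklore] `−Re Δ ≤ ‖Δ‖`. -/
theorem neg_re_le_norm (w : ℂ) : -w.re ≤ ‖w‖ :=
  (neg_le_abs w.re).trans (Complex.abs_re_le_norm w)

/-- [folklore] THE TILTED WEIGHT WITH ROOM: under `‖Δ‖ ≤ ρP + β`, `P ≥ 0` and `u + ρ ≤ u′`,
`e^{uP}e^{−Re Δ} ≤ e^{β}e^{u′P}`. -/
theorem tilted_weight_le {Δ : ℂ} {P ρ β u u' : ℝ} (hdom : ‖Δ‖ ≤ ρ * P + β) (hP : 0 ≤ P) (hu : u + ρ ≤ u') :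
    Real.exp (u * P) * Real.exp (-Δ.re) ≤ Real.exp β * Real.exp (u' * P) := by
  rw [← Real.exp_add, ← Real.exp_add]
  apply Real.exp_le_exp.mpr
  have h1 := neg_re_le_norm Δ
  nlinarith

/-- [folklore] MAJORANT TRANSFER (the displaced endpoint's (ROB) datum, integrability included).  Under `‖Δ‖ ≤ ρP + β`,
`P ≥ 0`, `u + ρ ≤ u′`, the a.e.-strong measurability of `Δ`, `P`, `F`, and the REFERENCE majorant at the larger growth
`∫ e^{u′P}‖F‖ dν ≤ M` (integrable): the displaced tilted majorant `e^{uP}e^{−Re Δ}‖F‖` is integrable with integral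
`≤ e^{β}M` — the hypotheses `hIA`, `hMA` of `T4ActivityTilt.norm_integral_tilt_sub_le` / `norm_tiltedTerm_sub_le` and of
every junction built on them. -/
theorem majorant_transfer [MeasurableSpace Ω] (ν : Measure Ω) (F : Ω → E) (Δ : Ω → ℂ) (P : Ω → ℝ)
    {ρ β u u' M : ℝ} (hdom : ∀ x, ‖Δ x‖ ≤ ρ * P x + β) (hP : ∀ x, 0 ≤ P x) (hu : u + ρ ≤ u')
    (hΔm : AEStronglyMeasurable Δ ν) (hPm : AEStronglyMeasurable P ν) (hFm : AEStronglyMeasurable F ν)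
    (hI : Integrable (fun x => Real.exp (u' * P x) * ‖F x‖) ν)
    (hM : ∫ x, Real.exp (u' * P x) * ‖F x‖ ∂ν ≤ M) :
    Integrable (fun x => Real.exp (u * P x) * Real.exp (-(Δ x).re) * ‖F x‖) ν ∧
      ∫ x, Real.exp (u * P x) * Real.exp (-(Δ x).re) * ‖F x‖ ∂ν ≤ Real.exp β * M := by
  have hpt : ∀ x, Real.exp (u * P x) * Real.exp (-(Δ x).re) * ‖F x‖
      ≤ Real.exp β * (Real.exp (u' * P x) * ‖F x‖) := fun x =>
    calc Real.exp (u * P x) * Real.exp (-(Δ x).re) * ‖F x‖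
        ≤ (Real.exp β * Real.exp (u' * P x)) * ‖F x‖ :=
          mul_le_mul_of_nonneg_right (tilted_weight_le (hdom x) (hP x) hu) (norm_nonneg _)
      _ = Real.exp β * (Real.exp (u' * P x) * ‖F x‖) := by ring
  have hmeas : AEStronglyMeasurable (fun x => Real.exp (u * P x) * Real.exp (-(Δ x).re) * ‖F x‖) ν := by
    have h1 : AEMeasurable (fun x => Real.exp (u * P x)) ν := (hPm.aemeasurable.const_mul u).exp
    have h2 : AEMeasurable (fun x => Real.exp (-(Δ x).re)) ν :=
      (Complex.measurable_re.comp_aemeasurable hΔm.aemeasurable).neg.exp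
    have h3 : AEMeasurable (fun x => ‖F x‖) ν := hFm.norm.aemeasurable
    exact ((h1.mul h2).mul h3).aestronglyMeasurable
  have hint : Integrable (fun x => Real.exp (u * P x) * Real.exp (-(Δ x).re) * ‖F x‖) ν :=
    Integrable.mono' (hI.const_mul (Real.exp β)) hmeas
      (Filter.Eventually.of_forall fun x => by
        rw [Real.norm_of_nonneg (by positivity)]; exact hpt x)
  refine ⟨hint, ?_⟩
  calc ∫ x, Real.exp (u * P x) * Real.exp (-(Δ x).re) * ‖F x‖ ∂ν
      ≤ ∫ x, Real.exp β * (Real.exp (u' * P x) * ‖F x‖) ∂ν := integral_mono hint (hI.const_mul _) hpt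
    _ = Real.exp β * ∫ x, Real.exp (u' * P x) * ‖F x‖ ∂ν := integral_const_mul _ _
    _ ≤ Real.exp β * M := mul_le_mul_of_nonneg_left hM (Real.exp_pos _).le

/-- [folklore] THE DISPLACED INTEGRAND IS INTEGRABLE: under `‖Δ‖ ≤ ρP + β`, `P ≥ 0`, `ρ ≤ u′`, measurability of `Δ` and
`F`, and the reference majorant `∫ e^{u′P}‖F‖ dν < ∞`, the displaced integrand `e^{−Δ}•F` is Bochner integrable — the
hypothesis `hFA` of `T4ActivityTilt.norm_tiltedTerm_sub_le` (and `hφA` of §14.3). -/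
theorem integrable_tilted [NormedSpace ℂ E] [MeasurableSpace Ω] (ν : Measure Ω) (F : Ω → E) (Δ : Ω → ℂ) (P : Ω → ℝ)
    {ρ β u' : ℝ} (hdom : ∀ x, ‖Δ x‖ ≤ ρ * P x + β) (hP : ∀ x, 0 ≤ P x) (hρu : ρ ≤ u')
    (hΔm : AEStronglyMeasurable Δ ν) (hFm : AEStronglyMeasurable F ν)
    (hI : Integrable (fun x => Real.exp (u' * P x) * ‖F x‖) ν) :
    Integrable (fun x => Complex.exp (-Δ x) • F x) ν := by
  refine Integrable.mono' (hI.const_mul (Real.exp β))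
    ((Complex.continuous_exp.comp_aestronglyMeasurable hΔm.neg).smul hFm)
    (Filter.Eventually.of_forall fun x => ?_)
  rw [norm_smul, Complex.norm_exp, Complex.neg_re]
  have h1 : -(Δ x).re ≤ β + u' * P x := by
    have h := neg_re_le_norm (Δ x)
    have hd := hdom x
    have hPx := hP x
    nlinarith
  calc Real.exp (-(Δ x).re) * ‖F x‖ ≤ Real.exp (β + u' * P x) * ‖F x‖ :=
        mul_le_mul_of_nonneg_right (Real.exp_le_exp.mpr h1) (norm_nonneg _)
    _ = Real.exp β * (Real.exp (u' * P x) * ‖F x‖) := by rw [Real.exp_add]; ring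

/-- [folklore] THE REFERENCE MAJORANT WEAKENED: `∫ e^{uP}‖F‖ ≤ ∫ e^{u′P}‖F‖ ≤ M` for `u ≤ u′`, `P ≥ 0` (the reference
endpoint's own (ROB) datum at growth `u` from the datum with room; integrability included). -/
theorem majorant_mono [MeasurableSpace Ω] (ν : Measure Ω) (F : Ω → E) (P : Ω → ℝ) {u u' M : ℝ}
    (hP : ∀ x, 0 ≤ P x) (hu : u ≤ u') (hPm : AEStronglyMeasurable P ν) (hFm : AEStronglyMeasurable F ν)
    (hI : Integrable (fun x => Real.exp (u' * P x) * ‖F x‖) ν)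
    (hM : ∫ x, Real.exp (u' * P x) * ‖F x‖ ∂ν ≤ M) :
    Integrable (fun x => Real.exp (u * P x) * ‖F x‖) ν ∧ ∫ x, Real.exp (u * P x) * ‖F x‖ ∂ν ≤ M := by
  have hpt : ∀ x, Real.exp (u * P x) * ‖F x‖ ≤ Real.exp (u' * P x) * ‖F x‖ := fun x =>
    mul_le_mul_of_nonneg_right (Real.exp_le_exp.mpr (mul_le_mul_of_nonneg_right hu (hP x))) (norm_nonneg _)
  have hmeas : AEStronglyMeasurable (fun x => Real.exp (u * P x) * ‖F x‖) ν :=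
    ((hPm.aemeasurable.const_mul u).exp.mul hFm.norm.aemeasurable).aestronglyMeasurable
  have hint : Integrable (fun x => Real.exp (u * P x) * ‖F x‖) ν :=
    Integrable.mono' hI hmeas (Filter.Eventually.of_forall fun x => by
      rw [Real.norm_of_nonneg (by positivity)]; exact hpt x)
  exact ⟨hint, (integral_mono hint hI hpt).trans hM⟩

/-! ## §14.5 Bookkeeping one-liners and the toy instances [folklore] -/

/-- [folklore] (bookkeeping) The displaced kernel's one-run bound from the reference bound and the displacement:
`‖L_q‖ ≤ ‖L_p‖ + ‖L_q − L_p‖ ≤ (m + r)·w`. -/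
theorem norm_le_of_near {G : Type*} [SeminormedAddCommGroup G] {x y : G} {m r w : ℝ}
    (hx : ‖x‖ ≤ m * w) (hd : ‖y - x‖ ≤ r * w) : ‖y‖ ≤ (m + r) * w := by
  have h := norm_le_norm_add_norm_sub' y x
  have h' : ‖y‖ ≤ ‖x‖ + ‖y - x‖ := by
    have := norm_add_le x (y - x); rwa [add_sub_cancel] at this
  linarith

/-- [folklore] (bookkeeping) A common constant for both endpoints: `c ≤ c/(1 − x)` for `0 ≤ c`, `0 ≤ x < 1` (so the
reference data may be entered into a junction at the displaced endpoint's larger constant). -/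
theorem self_le_div_one_sub {c x : ℝ} (hc : 0 ≤ c) (hx : 0 ≤ x) (hx1 : x < 1) : c ≤ c / (1 - x) := by
  rw [le_div_iff₀ (by linarith)]
  nlinarith

namespace Toy

open Literature.MathematicalPhysics.QuantumFieldTheory.Balaban1983to89.T4ActivityTilt.Toy
  (d2 d2_nonneg d2_triangle Ad Kd2 sum_d2 isUnit_shift_Ad_det norm_resolvent_Ad_le norm_Ad_sub_le)

/-- [folklore] Toy instance of `resolvent_near` on the `2 × 2` toy of `T4ActivityTilt` §10.1 (reference operator
`A_1 = 𝟙`, displacement `E = A_{1+t} − A_1`, `c = a = 1`, rate `2`, `K = 1 + e^{−1}`): for `|t|·K² < 1` every shift of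
the displaced operator is invertible and its resolvent obeys `‖R(u)(i, j)‖ ≤ 1/(1 − |t|K²)·1/(1 + u²)·e^{−d2(i, j)}` —
every hypothesis of the reach lemma discharged on concrete complex data. -/
theorem toy_resolvent_near {t : ℝ} (ht : 1 * |t| * Kd2 ^ 2 < 1) :
    (∀ u : ℝ, IsUnit ((((u ^ 2 : ℝ) : ℂ)) • (1 : Matrix (Fin 2) (Fin 2) ℂ) + (Ad 1 + (Ad (1 + t) - Ad 1))).det) ∧
      ∀ (u : ℝ) (i j : Fin 2), ‖T4ActivityTilt.resolvent (Ad 1 + (Ad (1 + t) - Ad 1)) u i j‖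
        ≤ 1 / (1 - 1 * |t| * Kd2 ^ 2) * lorentz 1 u * Real.exp (-(2 / 2 * d2 i j)) :=
  resolvent_near (S := Fin 2) d2 d2_nonneg d2_triangle id (Ad 1) (Ad (1 + t) - Ad 1)
    (fun u => isUnit_shift_Ad_det one_pos u) (c := 1) (a := 1) (r := |t|) (δ := 2) (K := Kd2)
    zero_le_one one_pos (abs_nonneg t) (by norm_num)
    (fun u i j => norm_resolvent_Ad_le le_rfl u i j)
    (fun i j => by rw [Matrix.sub_apply]; exact norm_Ad_sub_le t i j) sum_d2 ht

/-- [folklore] Toy check that the displaced operator of `toy_resolvent_near` IS `A_{1+t}`. -/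
theorem toy_displaced_eq (t : ℝ) : Ad 1 + (Ad (1 + t) - Ad 1) = Ad (1 + t) := add_sub_cancel (Ad 1) (Ad (1 + t))

/-- [folklore] Toy instance of the determinant bootstrap: `z_p = 2`, `z_q = 2 + w` with `‖w‖ ≤ 1/2` gives `z_q ≠ 0` and
`‖z_p/z_q − 1‖ ≤ 2·(1/2)/2`. -/
theorem toy_near_ne_zero {w : ℂ} (hw : ‖w‖ ≤ 1 / 2) :
    (2 : ℂ) + w ≠ 0 ∧ ‖(2 : ℂ)‖ / 2 ≤ ‖(2 : ℂ) + w‖ ∧ ‖(2 : ℂ) / (2 + w) - 1‖ ≤ 2 * (1 / 2) / ‖(2 : ℂ)‖ :=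
  near_ne_zero (zp := 2) (zq := 2 + w) two_ne_zero (by rwa [add_sub_cancel_left])
    (by rw [Complex.norm_two]; norm_num)

end Toy

end Literature.MathematicalPhysics.QuantumFieldTheory.Balaban1983to89.T4ActivityReach
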